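import Summits.NavierStokesRegularity.NavierStokesRegularity.Theorems.CertifiedBlowupCertifiedBlowupAxisymBlowupNoExtinction
import Literature.Analysis.FluidPDE.NecasRuzickaSverakHolds
import Literature.Analysis.FluidPDE.LerayHopfNSRescale
import HarnessLib

/-!
# Witnesses of the crux `CertifiedBlowupAxisymBlowup`: no Leray backward self-similar blow-up

Theorems file landed `--supports stmt-NavierStokesRegularity-0727`, line `compact-amplification`
(continuation lead c4, wave 1; registered stub `not_leraySelfSimilar_of_isMaximalSmoothSolution`).
The crux asks for a viscosity `ν > 0`, a time `T > 0` and a maximal smooth solution `(u, p)` of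
lifespan `T`, Leray–Hopf on `[0, T]` from its rapidly decaying axisymmetric datum `u 0`. This file
proves, for an ARBITRARY such witness `(ν, T, u, p)` and using only PROVED theorems of the tree,
that the witness is NOT of Leray's backward self-similar form
`u(t, x) = (2a(T−t))^{-1/2} U((x − x₀)/√(2a(T−t)))` (`lerayBackward a T U t (x - x₀)`) about ANY
centre `x₀`, for ANY rate `a > 0` and ANY Leray profile `(U, P)` (`IsLerayProfile ν a U P`), on
ANY final window `(t₁, T)`:

* the slice `u t` at `t = (t₁ + T)/2` is an `L³` field (the solution is a Kato `C([0,T); L³)`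
  solution, `isKatoSolutionOn_of_classical`);
* the ansatz at time `t` inverts to `U = L u(t, x₀ + L ·)`, `L = √(2a(T−t)) > 0`, so `U ∈ L³(ℝ³)`
  (translation and dilation invariance of `L³`, `MemLp.comp_measurePreserving`,
  `memLp_nsRescaleData`);
* Nečas–Růžička–Šverák 1996, Thm. 1 (the tree's discharged `necas_ruzicka_sverak_holds`):
  `U ≡ 0`, hence `u ≡ 0` on `(t₁, T) × ℝ³`;
* which contradicts the landed no-extinction theorem
  `not_tendsto_zero_of_isMaximalSmoothSolution` (backward uniqueness + continuation of bounded
  solutions): the pairings `∫⟪u(t), φ⟫` vanish identically near `T`, so they tend to `0`.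

No new definitions, no named-fact hypotheses, no `sorry`.

## References

* J. Nečas, M. Růžička, V. Šverák, *On Leray's self-similar solutions of the Navier–Stokes
  equations*, Acta Math. 176 (1996), 283–294, Thm. 1 (p. 291). [NecasRuzickaSverak1996]
* J. Leray, *Sur le mouvement d'un liquide visqueux emplissant l'espace*, Acta Math. 63 (1934),
  §20 (3.11). [Leray1934]
* P. G. Lemarié-Rieusset, *The Navier–Stokes Problem in the 21st Century*, CRC 2016, Thm. 15.4
  (p. 568). [LemarieRieusset2016]
-/

-- the summit and its single problem share the name (D-0017 nested layout)
set_option linter.dupNamespace false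

noncomputable section

open MeasureTheory Set Function Filter Topology Metric
open scoped ENNReal NNReal

namespace Summit.NavierStokesRegularity.NavierStokesRegularity.Theorems.CertifiedBlowupAxisymBlowup.CompactAmplification

open Literature.Analysis Literature.Analysis.FluidPDE

/-- **No witness of the crux is a Leray backward self-similar solution** (registered stub of
stmt-NavierStokesRegularity-0727; Nečas–Růžička–Šverák 1996, Thm. 1: the only Leray profile in
`L³(ℝ³)` is `U ≡ 0`). For every maximal Leray–Hopf classical solution `(u, p)` of viscosity `ν > 0`
and finite lifespan `T > 0` from a rapidly decaying axisymmetric datum, every centre `x₀`, rate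
`a > 0`, Leray profile `(U, P)` and `0 ≤ t₁ < T`, the identity
`u(t, x) = (2a(T−t))^{-1/2} U((x − x₀)/√(2a(T−t)))` FAILS somewhere on `(t₁, T) × ℝ³`: otherwise the
`L³` slice `u((t₁+T)/2)` (Kato class, `isKatoSolutionOn_of_classical`) rescales and translates to
`U ∈ L³`, so `U = 0` (`necas_ruzicka_sverak_holds`), `u ≡ 0` on `(t₁, T) × ℝ³`, and the pairings
`∫⟪u(t), φ⟫` tend to `0` as `t ↑ T`, contradicting `not_tendsto_zero_of_isMaximalSmoothSolution`.
[cite: NecasRuzickaSverak1996, Thm 1 (p. 291)] -/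
theorem not_leraySelfSimilar_of_isMaximalSmoothSolution : ∀ {ν T : ℝ} {u : ℝ → EuclideanSpace ℝ (Fin 3) → EuclideanSpace ℝ (Fin 3)} {p : ℝ → EuclideanSpace ℝ (Fin 3) → ℝ}, 0 < ν → 0 < T → IsMaximalSmoothSolution ν 0 u p T → IsLerayHopfOn T ν 0 (u 0) u → HasRapidSpatialDecay (u 0) → IsAxisymmetric (u 0) → ∀ (x₀ : EuclideanSpace ℝ (Fin 3)) (a : ℝ), 0 < a → ∀ (U : EuclideanSpace ℝ (Fin 3) → EuclideanSpace ℝ (Fin 3)) (P : EuclideanSpace ℝ (Fin 3) → ℝ), IsLerayProfile ν a U P → ∀ t₁ : ℝ, 0 ≤ t₁ → t₁ < T → ¬ ∀ t ∈ Set.Ioo t₁ T, ∀ x, u t x = lerayBackward a T U t (x - x₀) := by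
  intro ν T u p hν hT hmax hLH hdec haxi x₀ a ha U P hprof t₁ ht₁ ht₁T hans
  -- (1) the slice at the midpoint `t = (t₁ + T)/2` is an `L³` field
  set t : ℝ := (t₁ + T) / 2 with ht_def
  have ht : t ∈ Ioo t₁ T := ⟨by rw [ht_def]; linarith, by rw [ht_def]; linarith⟩
  have hu3 : MemLp (u t) 3 volume :=
    (isKatoSolutionOn_of_classical hν hT hmax.1 hLH hdec).memLp ⟨ht₁.trans ht.1.le, ht.2⟩
  -- (2) invert the ansatz at time `t`: `U = L • u t (x₀ + L • ·)`, `L = √(2a(T - t)) > 0`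
  set L : ℝ := Real.sqrt (2 * a * (T - t)) with hL_def
  have hL : 0 < L := Real.sqrt_pos.2 (by nlinarith [ht.2])
  have hUeq : U = nsRescaleData L (fun z => u t (x₀ + z)) := by
    funext y
    have h1 := hans t ht (x₀ + L • y)
    rw [lerayBackward_apply, ← hL_def, add_sub_cancel_left, smul_smul, inv_mul_cancel₀ hL.ne',
      one_smul] at h1
    rw [nsRescaleData_apply, h1, smul_smul, mul_inv_cancel₀ hL.ne', one_smul]
  have hU3 : MemLp U 3 volume := by
    rw [hUeq]
    refine memLp_nsRescaleData ?_ hL.ne'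
    exact hu3.comp_measurePreserving (measurePreserving_add_left volume x₀)
  -- (3) Nečas–Růžička–Šverák: `U = 0`, so `u ≡ 0` on `(t₁, T) × ℝ³`
  have hU0 : U = 0 := necas_ruzicka_sverak_holds hν ha hprof hU3
  have hzero : ∀ s ∈ Ioo t₁ T, ∀ x, u s x = 0 := fun s hs x => by
    rw [hans s hs x, hU0, lerayBackward_apply, Pi.zero_apply, smul_zero]
  -- (4) contradiction with no extinction at the blow-up time
  refine not_tendsto_zero_of_isMaximalSmoothSolution hν hT hmax hLH hdec haxi fun φ _ => ?_
  refine (tendsto_const_nhds (x := (0 : ℝ))).congr' ?_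
  filter_upwards [Ioo_mem_nhdsLT ht₁T] with s hs
  simp [hzero s hs]

end Summit.NavierStokesRegularity.NavierStokesRegularity.Theorems.CertifiedBlowupAxisymBlowup.CompactAmplification

end
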